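import Summits.AtomisticToContinuum.BoseEinsteinCondensation.Theorems.SoloInformedJeffreysBounds
import Summits.AtomisticToContinuum.BoseEinsteinCondensation.Theorems.SoloInformedJastrowMeanJeffreys

/-!
# Positive-definite Jastrow states are Bose condensed (finite configuration space)

Soloist report `solo-AtomisticToContinuum-informed`, `paper/sharpest.md` §4.8 (Theorem D).

**Theorem D (continuum form; proved on paper in the report).** Let `Λ ⊂ ℝ^d` be a box,
`u : ℝ^d → ℝ` even, bounded and of positive type (`û ≥ 0`), `h > 0` on `Λ`, and
`Ψ(x₁,…,x_N) = ∏ᵢ h(xᵢ) ∏_{i<j} e^{-u(xᵢ-xⱼ)/2}`. Let `η₁` be the one-particle density of `|Ψ|²`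
(normalised to `1`) and `φ = √η₁` (a unit vector). Then the one-particle density matrix obeys
`⟨φ, γ_Ψ φ⟩ / N ≥ exp(-½ [u(0) - ⟨η₁, u * η₁⟩]) ≥ e^{-u(0)/2}`
for every `N`, every `Λ` and every `h`: such states are condensed in the single mode `φ`, with
condensate fraction bounded below through the self-energy `u(0)/2`, which is Ruelle's stability
constant of a positive-type pair potential [cite: Ruelle1969, §3.2]; no condition on the sign of
`u(r)`, `r ≠ 0`, on its range or on its integrability enters (long-range tails allowed).

**What is kernel-checked in this file** is the same statement over an arbitrary finite
one-particle space `T` (sums instead of integrals; the continuum statement differs from it only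
by routine measure theory): `SoloInformed.sqrtDensity_occupation_ge_of_posDef` (abstract slice
form: any symmetric `Ψ > 0` on `T^{n+1}` whose slices are `Ψ(x,Y) = F(Y) h(x) e^{-½ ∑ⱼ K(x,Yⱼ)}`,
`K` symmetric, positive semi-definite on finite families, `K(x,x) ≤ κ`), the fraction form
`SoloInformed.condensateFraction_ge_exp_neg_half_selfEnergy`
(`∑_Y (∑ₓ √η(x) Ψ(x,Y))² / ∑_X Ψ(X)² ≥ e^{-κ/2}`), and the explicit Bijl–Dingle–Jastrow product
`SoloInformed.jastrowProduct_condensateFraction_ge`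
(`Ψ(X) = ∏ᵢ h(Xᵢ) exp(-¼(∑ᵢⱼ K(Xᵢ,Xⱼ) - ∑ᵢ K(Xᵢ,Xᵢ)))`).

**Proof.** (1) Slice inequality `SoloInformed.sq_sum_sqrt_mul_ge_exp_jeffreys`: for each
environment `Y`, with `S_Y = ∑ₓ Ψ(x,Y)²` and `p_Y = Ψ(·,Y)²/S_Y`,
`(∑ₓ √η(x) Ψ(x,Y))² = S_Y · BC(η,p_Y)² ≥ S_Y · e^{-J_Y/2}`, where `BC` is the Bhattacharyya
coefficient and `J_Y = KL(η‖p_Y) + KL(p_Y‖η)` the Jeffreys divergence (weighted AM–GM, twice).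
(2) Jensen over `Y` with weights `S_Y / ∑ S` (`SoloInformed.exp_sum_mul_le_sum_mul_exp`).
(3) `E[J_Y] ≤ κ - ⟨η,Kη⟩ ≤ κ` (`SoloInformed.sum_jeffreys_le_of_posDef`): writing
`J_Y = ∑ₓ (η - p_Y)(log η - 2 log h + W_Y)` with `W_Y(x) = ∑ⱼ K(x,Yⱼ)` (the normalisations
`S_Y`, `F(Y)` drop out because `∑ₓ (η - p_Y) = 0`), the one-body logarithms cancel on average
because `E p_Y = η`, the pair terms give `E ∑ₓ (η - p_Y) W_Y = n⟨η,Kη⟩ - E ∑_{j≥1} K(X₀,Xⱼ)`, and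
positive semi-definiteness of `K` on the signed measure `∑ᵢ δ_{Xᵢ} - (n+1) η` yields
`E ∑_{j≥1} K(X₀,Xⱼ) ≥ (n+1)⟨η,Kη⟩ - κ`.

**Status.** Off-path for `Summit.AtomisticToContinuum.BoseEinsteinCondensation` (trial states,
not ground states); it is the rigorous form of the "pair-level long-range dressing costs no
condensate" half of the obstruction analysis of the report (§4.7–§4.8): for the interacting ground
state the missing input remains the non-pair part of `-2 log Ψ₀(x | X̂)`.
**Literature.** Reatto [cite: Reatto1969] proved macroscopic occupation of the zero mode for
Jastrow functions with pseudopotentials whose one-particle energy is bounded below and whose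
activity is finite (hypotheses as restated in [cite: ZhaiWu2005, §3]); the present statement is
complementary in class (positive type with finite self-energy; sign and tails unrestricted) and in
method (entropic, finite volume, no thermodynamic-limit input). Cf. [cite: PenroseOnsager1956, §5].
-/

noncomputable section

open Finset

namespace Summit.AtomisticToContinuum.BoseEinsteinCondensation.Theorems

section Jastrow

variable {T : Type*} [Fintype T] [Nonempty T] {n : ℕ}

/-- **Positive-definite Jastrow states are Bose condensed, uniformly** (finite configuration
space; soloist report `paper/sharpest.md` §4.8, Theorem D). Let `T` be a finite one-particle
configuration space, `K : T → T → ℝ` a symmetric kernel, positive semi-definite on every finite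
family (`∑ᵢⱼ cᵢ cⱼ K(zᵢ, zⱼ) ≥ 0`) with diagonal `K(x,x) ≤ κ`, `h : T → (0,∞)` an arbitrary
one-body factor, and `Ψ > 0` a symmetric `(n+1)`-particle function whose slices are of Jastrow
form `Ψ(x, Y) = F(Y) · h(x) · exp(-½ ∑ⱼ K(x, Yⱼ))` (e.g. the Bijl–Dingle–Jastrow state
`∏ᵢ h(xᵢ) ∏_{i<j} e^{-K(xᵢ,xⱼ)/2}`; `F` carries all correlations of the others). Let
`η(x) = ∑_Y Ψ(x,Y)² / ∑_X Ψ(X)²` be the one-particle density and `φ = √η` (a unit vector of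
`ℓ²(T)`). Then the occupation of the mode `φ` in the one-particle density matrix
`γ_Ψ = N ∑_Y |Ψ(·,Y)⟩⟨Ψ(·,Y)| / ‖Ψ‖²`, `N = n + 1`, obeys
`⟨φ, γ_Ψ φ⟩ = N ∑_Y (∑ₓ φ(x) Ψ(x,Y))² / ∑_X Ψ(X)² ≥ N · e^{-κ/2}`:
a fraction at least `e^{-κ/2}` of the particles is condensed in the single mode `φ`, for every
particle number, every `T` (every volume), every `h` and every `F`. The self-energy `κ/2` is
Ruelle's stability constant of a positive-type pair potential; no smallness, range or
integrability condition on `K` enters. Proof: slice inequality (Jeffreys/Bhattacharyya), Jensen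
over the environment, and `SoloInformed.sum_jeffreys_le_of_posDef`.
Complementary to L. Reatto, Phys. Rev. 183 (1969) 334 (pseudopotentials with one-particle
energy bounded below and finite activity, as restated in [cite: ZhaiWu2005, §3]);
cf. [cite: PenroseOnsager1956, §5]. -/
theorem SoloInformed.sqrtDensity_occupation_ge_of_posDef
    (K : T → T → ℝ) (hKs : ∀ x y, K x y = K y x)
    (hK : ∀ (m : ℕ) (z : Fin m → T) (c : Fin m → ℝ), 0 ≤ ∑ i, ∑ j, c i * c j * K (z i) (z j))
    {κ : ℝ} (hκ : ∀ x, K x x ≤ κ)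
    (h : T → ℝ) (hh : ∀ x, 0 < h x) (F : (Fin n → T) → ℝ) (hF : ∀ Y, 0 < F Y)
    (Ψ : (Fin (n + 1) → T) → ℝ)
    (hsymm : ∀ (σ : Equiv.Perm (Fin (n + 1))) (X : Fin (n + 1) → T), Ψ (X ∘ σ) = Ψ X)
    (hslice : ∀ (x : T) (Y : Fin n → T),
      Ψ (Matrix.vecCons x Y) = F Y * (h x * Real.exp (-(1 / 2) * ∑ j, K x (Y j))))
    (η : T → ℝ) (hη : ∀ x, η x = (∑ Y : Fin n → T, Ψ (Matrix.vecCons x Y) ^ 2) / ∑ X, Ψ X ^ 2) :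
    ((n + 1 : ℝ) * Real.exp (-(κ / 2))) * ∑ X, Ψ X ^ 2 ≤
      (n + 1 : ℝ) * ∑ Y : Fin n → T, (∑ x, Real.sqrt (η x) * Ψ (Matrix.vecCons x Y)) ^ 2 := by
  have hQ := SoloInformed.sum_jeffreys_le_of_posDef K hKs hK hκ h hh F hF Ψ hsymm hslice η hη
  have hsplit : ∀ Φ : (Fin (n + 1) → T) → ℝ,
      ∑ X, Φ X = ∑ x, ∑ Y, Φ (Matrix.vecCons x Y) := SoloInformed.sum_config_eq_sum_vecCons
  have hg : ∀ (x : T) (Y : Fin n → T), 0 < Ψ (Matrix.vecCons x Y) := fun x Y => by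
    rw [hslice]; exact mul_pos (hF Y) (mul_pos (hh x) (Real.exp_pos _))
  obtain ⟨Z, hZ⟩ : ∃ r : ℝ, r = ∑ X, Ψ X ^ 2 := ⟨_, rfl⟩
  rw [← hZ] at hη hQ ⊢
  have hZ' : Z = ∑ x, ∑ Y : Fin n → T, Ψ (Matrix.vecCons x Y) ^ 2 := by
    rw [hZ]; exact hsplit fun X => Ψ X ^ 2
  have hSpos : ∀ Y : Fin n → T, 0 < ∑ x, Ψ (Matrix.vecCons x Y) ^ 2 := fun Y =>
    Finset.sum_pos (fun x _ => pow_pos (hg x Y) 2) Finset.univ_nonempty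
  have hZpos : 0 < Z := by
    rw [hZ']
    exact Finset.sum_pos (fun x _ => Finset.sum_pos (fun Y _ => pow_pos (hg x Y) 2)
      Finset.univ_nonempty) Finset.univ_nonempty
  have hηpos : ∀ x, 0 < η x := fun x => by
    rw [hη]
    exact div_pos (Finset.sum_pos (fun Y _ => pow_pos (hg x Y) 2) Finset.univ_nonempty) hZpos
  have hmarg : ∀ x, ∑ Y : Fin n → T, Ψ (Matrix.vecCons x Y) ^ 2 = η x * Z := fun x => by
    rw [hη, div_mul_cancel₀ _ hZpos.ne']
  have hη1 : ∑ x, η x = 1 := by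
    have h1 : (∑ x, η x) * Z = 1 * Z := by
      rw [Finset.sum_mul, one_mul]
      calc ∑ x, η x * Z = ∑ x, ∑ Y : Fin n → T, Ψ (Matrix.vecCons x Y) ^ 2 :=
            Finset.sum_congr rfl fun x _ => (hmarg x).symm
        _ = Z := hZ'.symm
    exact mul_right_cancel₀ hZpos.ne' h1
  -- names for the slice norms and the (multiplied) Jeffreys sums
  obtain ⟨S, hS⟩ : ∃ f : (Fin n → T) → ℝ, f = fun Y => ∑ x, Ψ (Matrix.vecCons x Y) ^ 2 :=
    ⟨_, rfl⟩
  obtain ⟨J, hJ⟩ : ∃ f : (Fin n → T) → ℝ, f = fun Y => ∑ x, (η x * (∑ x', Ψ (Matrix.vecCons x' Y) ^ 2) -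
      Ψ (Matrix.vecCons x Y) ^ 2) * (Real.log (η x) - Real.log (Ψ (Matrix.vecCons x Y) ^ 2)) :=
    ⟨_, rfl⟩
  have hSpos' : ∀ Y, 0 < S Y := fun Y => by rw [hS]; exact hSpos Y
  have hslice' : ∀ Y : Fin n → T, S Y * Real.exp (-(1 / 2) * (J Y / S Y)) ≤
      (∑ x, Real.sqrt (η x) * Ψ (Matrix.vecCons x Y)) ^ 2 := by
    intro Y
    have h1 := SoloInformed.sq_sum_sqrt_mul_ge_exp_jeffreys Finset.univ η
      (fun x => Ψ (Matrix.vecCons x Y)) (fun x _ => hηpos x) (fun x _ => hg x Y) hη1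
    rw [hS, hJ]
    exact h1
  have hZS : Z = ∑ Y, S Y := by rw [hZ', hS]; exact Finset.sum_comm
  have hQ' : ∑ Y, J Y ≤ κ * Z := by rw [hJ]; exact hQ
  -- Jensen over the environment with weights `S_Y / Z`
  have hw1 : ∑ Y, S Y / Z = 1 := by rw [← Finset.sum_div, ← hZS, div_self hZpos.ne']
  have hjen := SoloInformed.exp_sum_mul_le_sum_mul_exp Finset.univ (fun Y => S Y / Z)
    (fun Y => -(1 / 2) * (J Y / S Y)) (fun Y _ => (div_pos (hSpos' Y) hZpos).le) hw1
  have hexponent : -(κ / 2) ≤ ∑ Y, S Y / Z * (-(1 / 2) * (J Y / S Y)) := by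
    have h1 : ∑ Y, S Y / Z * (-(1 / 2) * (J Y / S Y)) = -(1 / 2) * ((∑ Y, J Y) / Z) := by
      rw [Finset.sum_div, Finset.mul_sum]
      refine Finset.sum_congr rfl fun Y _ => ?_
      have hS0 : S Y ≠ 0 := (hSpos' Y).ne'
      have hZ0 : Z ≠ 0 := hZpos.ne'
      field_simp
    have h2 : (∑ Y, J Y) / Z ≤ κ := by
      rw [div_le_iff₀ hZpos]
      exact hQ'
    rw [h1]
    linarith
  calc (n + 1 : ℝ) * Real.exp (-(κ / 2)) * Z
      ≤ (n + 1) * (Z * Real.exp (∑ Y, S Y / Z * (-(1 / 2) * (J Y / S Y)))) := by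
        rw [mul_assoc]
        refine mul_le_mul_of_nonneg_left ?_ (by positivity)
        rw [mul_comm]
        exact mul_le_mul_of_nonneg_left (Real.exp_le_exp.2 hexponent) hZpos.le
    _ ≤ (n + 1) * (Z * ∑ Y, S Y / Z * Real.exp (-(1 / 2) * (J Y / S Y))) :=
        mul_le_mul_of_nonneg_left (mul_le_mul_of_nonneg_left hjen hZpos.le) (by positivity)
    _ = (n + 1) * ∑ Y, S Y * Real.exp (-(1 / 2) * (J Y / S Y)) := by
        congr 1
        rw [Finset.mul_sum]
        refine Finset.sum_congr rfl fun Y _ => ?_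
        rw [mul_left_comm, ← mul_assoc, div_mul_cancel₀ _ hZpos.ne']
    _ ≤ (n + 1) * ∑ Y : Fin n → T, (∑ x, Real.sqrt (η x) * Ψ (Matrix.vecCons x Y)) ^ 2 :=
        mul_le_mul_of_nonneg_left (Finset.sum_le_sum fun Y _ => hslice' Y) (by positivity)

/-- **Condensate-fraction form** of `SoloInformed.sqrtDensity_occupation_ge_of_posDef`:
`⟨φ, γ_Ψ φ⟩ / N = ∑_Y (∑ₓ φ(x) Ψ(x,Y))² / ∑_X Ψ(X)² ≥ e^{-κ/2}` for `φ = √η`. -/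
theorem SoloInformed.condensateFraction_ge_exp_neg_half_selfEnergy
    (K : T → T → ℝ) (hKs : ∀ x y, K x y = K y x)
    (hK : ∀ (m : ℕ) (z : Fin m → T) (c : Fin m → ℝ), 0 ≤ ∑ i, ∑ j, c i * c j * K (z i) (z j))
    {κ : ℝ} (hκ : ∀ x, K x x ≤ κ)
    (h : T → ℝ) (hh : ∀ x, 0 < h x) (F : (Fin n → T) → ℝ) (hF : ∀ Y, 0 < F Y)
    (Ψ : (Fin (n + 1) → T) → ℝ)
    (hsymm : ∀ (σ : Equiv.Perm (Fin (n + 1))) (X : Fin (n + 1) → T), Ψ (X ∘ σ) = Ψ X)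
    (hslice : ∀ (x : T) (Y : Fin n → T),
      Ψ (Matrix.vecCons x Y) = F Y * (h x * Real.exp (-(1 / 2) * ∑ j, K x (Y j))))
    (η : T → ℝ) (hη : ∀ x, η x = (∑ Y : Fin n → T, Ψ (Matrix.vecCons x Y) ^ 2) / ∑ X, Ψ X ^ 2) :
    Real.exp (-(κ / 2)) ≤
      (∑ Y : Fin n → T, (∑ x, Real.sqrt (η x) * Ψ (Matrix.vecCons x Y)) ^ 2) / ∑ X, Ψ X ^ 2 := by
  have hmain := SoloInformed.sqrtDensity_occupation_ge_of_posDef K hKs hK hκ h hh F hF Ψ hsymm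
    hslice η hη
  have hg : ∀ (x : T) (Y : Fin n → T), 0 < Ψ (Matrix.vecCons x Y) := fun x Y => by
    rw [hslice]; exact mul_pos (hF Y) (mul_pos (hh x) (Real.exp_pos _))
  have hZpos : 0 < ∑ X, Ψ X ^ 2 := by
    rw [SoloInformed.sum_config_eq_sum_vecCons (fun X => Ψ X ^ 2)]
    exact Finset.sum_pos (fun x _ => Finset.sum_pos (fun Y _ => pow_pos (hg x Y) 2)
      Finset.univ_nonempty) Finset.univ_nonempty
  rw [le_div_iff₀ hZpos]
  have hN : (0 : ℝ) < n + 1 := by positivity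
  rw [mul_assoc] at hmain
  exact le_of_mul_le_mul_left hmain hN

/-- **The Bijl–Dingle–Jastrow state itself.** For
`Ψ(X) = ∏ᵢ h(Xᵢ) · exp(-¼ (∑ᵢⱼ K(Xᵢ,Xⱼ) - ∑ᵢ K(Xᵢ,Xᵢ))) = ∏ᵢ h(Xᵢ) ∏_{i<j} e^{-K(Xᵢ,Xⱼ)/2}`
with `K` symmetric, positive semi-definite, `K(x,x) ≤ κ`, and any `h > 0`, the condensate
fraction in the mode `√η` (η the one-particle density) is at least `e^{-κ/2}`, uniformly in the
particle number and in the (finite) one-particle space `T`. -/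
theorem SoloInformed.jastrowProduct_condensateFraction_ge
    (K : T → T → ℝ) (hKs : ∀ x y, K x y = K y x)
    (hK : ∀ (m : ℕ) (z : Fin m → T) (c : Fin m → ℝ), 0 ≤ ∑ i, ∑ j, c i * c j * K (z i) (z j))
    {κ : ℝ} (hκ : ∀ x, K x x ≤ κ) (h : T → ℝ) (hh : ∀ x, 0 < h x)
    (Ψ : (Fin (n + 1) → T) → ℝ)
    (hΨ : ∀ X, Ψ X = (∏ i, h (X i)) *
      Real.exp (-(1 / 4) * (∑ i, ∑ j, K (X i) (X j) - ∑ i, K (X i) (X i))))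
    (η : T → ℝ) (hη : ∀ x, η x = (∑ Y : Fin n → T, Ψ (Matrix.vecCons x Y) ^ 2) / ∑ X, Ψ X ^ 2) :
    Real.exp (-(κ / 2)) ≤
      (∑ Y : Fin n → T, (∑ x, Real.sqrt (η x) * Ψ (Matrix.vecCons x Y)) ^ 2) / ∑ X, Ψ X ^ 2 := by
  refine SoloInformed.condensateFraction_ge_exp_neg_half_selfEnergy K hKs hK hκ h hh
    (fun Y => (∏ j, h (Y j)) *
      Real.exp (-(1 / 4) * (∑ j, ∑ k, K (Y j) (Y k) - ∑ j, K (Y j) (Y j))))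
    (fun Y => mul_pos (Finset.prod_pos fun j _ => hh (Y j)) (Real.exp_pos _)) Ψ ?_ ?_ η hη
  · intro σ X
    rw [hΨ, hΨ]
    have e1 : ∏ i, h ((X ∘ σ) i) = ∏ i, h (X i) := Fintype.prod_equiv σ _ _ fun i => rfl
    have e2 : ∑ i, K ((X ∘ σ) i) ((X ∘ σ) i) = ∑ i, K (X i) (X i) :=
      Fintype.sum_equiv σ _ _ fun i => rfl
    have e3 : ∑ i, ∑ j, K ((X ∘ σ) i) ((X ∘ σ) j) = ∑ i, ∑ j, K (X i) (X j) :=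
      Fintype.sum_equiv σ _ _ fun i => Fintype.sum_equiv σ _ _ fun j => rfl
    rw [e1, e2, e3]
  · intro x Y
    have hsym : ∑ j : Fin n, K (Y j) x = ∑ j, K x (Y j) :=
      Finset.sum_congr rfl fun j _ => hKs _ _
    rw [mul_mul_mul_comm, ← Real.exp_add, hΨ]
    simp only [Fin.prod_univ_succ, Fin.sum_univ_succ, Matrix.cons_val_zero, Matrix.cons_val_succ,
      Finset.sum_add_distrib]
    rw [hsym]
    exact congrArg₂ (· * ·) (by ring) (congrArg Real.exp (by ring))

end Jastrow

end Summit.AtomisticToContinuum.BoseEinsteinCondensation.Theorems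

end
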